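import Summits.CriticalPhenomena.PercolationContinuityZ3.Theorems.PercNearOneGluingNoHeavyLowerTailIncStarWDOMAllOrNothingTargetCore
import Summits.CriticalPhenomena.PercolationContinuityZ3.Theorems.PercNearOneGluingNoHeavyLowerTailIncStarWDOMAllOrNothingEvents
import Summits.CriticalPhenomena.PercolationContinuityZ3.Theorems.PercNearOneGluingAdditiveGluingKnThm2GoodEvents
import HarnessLib

/-!
# The all-or-nothing lemma at a TARGET: the theorem (Sahi programme, prover prim-sahi-p2 gen 36)

Support file (`--supports stmt-CriticalPhenomena-4575`); no definitions, no named facts, no sorries; standard axioms.  Memo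
`run/shared/lean/prim/prim-sahi/FROM-prim-sahi-p2-gen36-ALL-OR-NOTHING.md` §2(2f), `prim-sahi-p2/PROOF-E3.md` §46.

**`allOrNothing_target`.**  `s, i, j` distinct; `F` a set of pairs containing the TARGET `i`, with `s(i,s), s(i,j) ∉ F`; `w⁰ s(i,v) = 0` for every
`v ∉ {i, s, j}` (the target hangs on `s` and `j` only; the rest of the graph ARBITRARY); `w¹ = w⁰[F ↦ 1]` (the target merged with its `F`-neighbours).
Then `q¹_i(q¹_j − q⁰_j) + q¹_j(q¹_i − q⁰_i) ≤ 2(q¹_{ij} − q⁰_{ij})` — the same `W`-comparison as for merging the ROOT (`allOrNothing_root`).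
Proof: pins at `e₁ = s(i,s)`, `e₂ = s(i,j)`; `P_{w¹} = P_{w⁰} ∘ (· ∪ F)⁻¹`; `{s↔i}` and `{i↔j}` by the last-exit lemma at `i`, `{s↔j} = {s ↔ j avoiding i} ∪ ({s↔i} ∩ {i↔j})`
(`reach_split_at`); the `H`-events `S_j, I_s, I_j` moved to `P⁰⁰`; the single Harris inequality `P(I_s)P(S_j) ≤ P(I_s ∩ S_j)`; core `allOrNothing_target_core`.
-/

noncomputable section

namespace Summit.CriticalPhenomena.PercolationContinuityZ3.Theorems

namespace IncStar

open MeasureTheory Set Literature.Probability.Percolation Literature.Probability.LatticeModels EdgeInduction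
open scoped Classical

variable {n : ℕ}

set_option maxHeartbeats 800000 in
/-- **ALL-OR-NOTHING LEMMA AT A TARGET.**  `s, i, j` distinct; `F` a set of pairs containing `i`, `s(i,s), s(i,j) ∉ F`; `w⁰ s(i,v) = 0` for all
`v ∉ {i,s,j}`; `w¹ = w⁰[F ↦ 1]`.  Then `q¹_i(q¹_j − q⁰_j) + q¹_j(q¹_i − q⁰_i) ≤ 2(q¹_{ij} − q⁰_{ij})` (notation in the module docstring). [this work] -/
theorem allOrNothing_target (w0 w1 : Sym2 (Fin n) → unitInterval) {s i j : Fin n} (his : i ≠ s) (hjs : j ≠ s) (hij : i ≠ j)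
    (F : Set (Sym2 (Fin n))) (hF : ∀ e ∈ F, i ∈ e) (hFs : s(i, s) ∉ F) (hFj : s(i, j) ∉ F)
    (htarget : ∀ v : Fin n, v ≠ i → v ≠ s → v ≠ j → w0 s(i, v) = 0)
    (hw1 : w1 = fun e => if e ∈ F then 1 else w0 e) :
    (prodBernoulli w1).real (openConn s i) * ((prodBernoulli w1).real (openConn s j) - (prodBernoulli w0).real (openConn s j))
      + (prodBernoulli w1).real (openConn s j) * ((prodBernoulli w1).real (openConn s i) - (prodBernoulli w0).real (openConn s i))
      ≤ 2 * ((prodBernoulli w1).real (openConn s i ∩ openConn s j) - (prodBernoulli w0).real (openConn s i ∩ openConn s j)) := by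
  set e₁ : Sym2 (Fin n) := s(i, s) with he₁
  set e₂ : Sym2 (Fin n) := s(i, j) with he₂
  have hne : e₁ ≠ e₂ := by
    rw [he₁, he₂]; intro h; rw [Sym2.eq_iff] at h; rcases h with ⟨_, h⟩ | ⟨_, h⟩; exacts [hjs h.symm, his h.symm]
  rw [knThm2_openConn_comm s i]
  set Bi : Set (BondConfig (Fin n)) := openConn i s with hBi; set Bj : Set (BondConfig (Fin n)) := openConn s j with hBj
  set IJ : Set (BondConfig (Fin n)) := openConn i j with hIJ
  set a : ℝ := (w0 e₁ : ℝ) with ha; set c : ℝ := (w0 e₂ : ℝ) with hc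
  have ha0 : 0 ≤ a := (w0 e₁).2.1; have ha1 : a ≤ 1 := (w0 e₁).2.2; have hc0 : 0 ≤ c := (w0 e₂).2.1; have hc1 : c ≤ 1 := (w0 e₂).2.2
  have hw1e₁ : (w1 e₁ : ℝ) = a := by rw [hw1]; simp only [if_neg hFs, ← ha]
  have hw1e₂ : (w1 e₂ : ℝ) = c := by rw [hw1]; simp only [if_neg hFj, ← hc]
  set Q00 := pin₂ w0 e₁ e₂ 0 0 with hQ00; set Q01 := pin₂ w0 e₁ e₂ 0 1 with hQ01
  set Q10 := pin₂ w0 e₁ e₂ 1 0 with hQ10; set Q11 := pin₂ w0 e₁ e₂ 1 1 with hQ11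
  haveI : IsProbabilityMeasure Q00 := by rw [hQ00]; unfold pin₂; infer_instance
  haveI : IsProbabilityMeasure Q01 := by rw [hQ01]; unfold pin₂; infer_instance
  haveI : IsProbabilityMeasure Q10 := by rw [hQ10]; unfold pin₂; infer_instance
  haveI : IsProbabilityMeasure Q11 := by rw [hQ11]; unfold pin₂; infer_instance
  have hpinF : ∀ x y : unitInterval, Function.update (Function.update w1 e₁ x) e₂ y =
      fun e => if e ∈ F then 1 else Function.update (Function.update w0 e₁ x) e₂ y e := by
    intro x y; funext e; rw [pin₂_update_apply w1 hne, pin₂_update_apply w0 hne]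
    by_cases h2 : e = e₂
    · subst h2; simp only [if_true, if_neg hFj]
    by_cases h1 : e = e₁
    · subst h1; simp only [if_neg h2, if_true, if_neg hFs]
    · simp only [if_neg h2, if_neg h1, hw1]
  have cplF : ∀ (x y : unitInterval) (X : Set (BondConfig (Fin n))),
      (pin₂ w1 e₁ e₂ x y).real X = (pin₂ w0 e₁ e₂ x y).real ((fun ω : BondConfig (Fin n) => ω ∪ F) ⁻¹' X) := by
    intro x y X; rw [pin₂, pin₂, hpinF x y]; exact real_map_union _ F X
  have cpl01 : ∀ X : Set (BondConfig (Fin n)), Q01.real X = Q00.real ((fun ω : BondConfig (Fin n) => insert e₂ ω) ⁻¹' X) :=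
    fun X => by rw [hQ01, hQ00]; exact pin₂_real_zero_one_eq_zero_zero w0 e₁ e₂ X
  have cpl10 : ∀ X : Set (BondConfig (Fin n)), Q10.real X = Q00.real ((fun ω : BondConfig (Fin n) => insert e₁ ω) ⁻¹' X) :=
    fun X => by rw [hQ10, hQ00]; exact pin₂_real_one_zero_eq_zero_zero w0 hne X
  set Sj : Set (BondConfig (Fin n)) := {ω | (openGraph (ω \ {f : Sym2 (Fin n) | i ∈ f})).Reachable s j} with hSj
  set Is : Set (BondConfig (Fin n)) :=
    {ω | ∃ u : Fin n, u ≠ i ∧ s(i, u) ∈ F ∧ (openGraph (ω \ {f : Sym2 (Fin n) | i ∈ f})).Reachable u s} with hIs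
  set Ij : Set (BondConfig (Fin n)) :=
    {ω | ∃ u : Fin n, u ≠ i ∧ s(i, u) ∈ F ∧ (openGraph (ω \ {f : Sym2 (Fin n) | i ∈ f})).Reachable u j} with hIj
  have hi₁ : i ∈ e₁ := by rw [he₁]; exact Sym2.mem_mk_left _ _
  have hi₂ : i ∈ e₂ := he₂ ▸ Sym2.mem_mk_left _ _
  have insSj : ∀ {e : Sym2 (Fin n)}, i ∈ e → ∀ ω : BondConfig (Fin n), insert e ω ∈ Sj ↔ ω ∈ Sj := by
    intro e he ω; simp only [hSj, Set.mem_setOf_eq]; rw [sdiff_rootPairs_insert he]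
  have insIs : ∀ {e : Sym2 (Fin n)}, i ∈ e → ∀ ω : BondConfig (Fin n), insert e ω ∈ Is ↔ ω ∈ Is := by
    intro e he ω; simp only [hIs, Set.mem_setOf_eq]; rw [sdiff_rootPairs_insert he]
  have insIj : ∀ {e : Sym2 (Fin n)}, i ∈ e → ∀ ω : BondConfig (Fin n), insert e ω ∈ Ij ↔ ω ∈ Ij := by
    intro e he ω; simp only [hIj, Set.mem_setOf_eq]; rw [sdiff_rootPairs_insert he]
  have unionSj : ∀ ω : BondConfig (Fin n), (ω ∪ F : BondConfig (Fin n)) ∈ Sj ↔ ω ∈ Sj := by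
    intro ω; simp only [hSj, Set.mem_setOf_eq]; rw [sdiff_rootPairs_union hF]
  have symSj : ∀ ω : BondConfig (Fin n), (openGraph (ω \ {f : Sym2 (Fin n) | i ∈ f})).Reachable j s ↔ ω ∈ Sj :=
    fun ω => ⟨fun h => h.symm, fun h => SimpleGraph.Reachable.symm h⟩
  have hISJ : ∀ ω, ω ∈ Is → ω ∈ Sj → ω ∈ Ij := by
    rintro ω ⟨u, hu, hsu, hr⟩ hS; exact ⟨u, hu, hsu, hr.trans hS⟩
  have hJSI : ∀ ω, ω ∈ Ij → ω ∈ Sj → ω ∈ Is := by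
    rintro ω ⟨u, hu, hsu, hr⟩ hS; exact ⟨u, hu, hsu, hr.trans (SimpleGraph.Reachable.symm hS)⟩
  have setSjIj : Sj ∩ Ij = Sj ∩ Is := by
    ext ω; simp only [Set.mem_inter_iff]; exact ⟨fun h => ⟨h.1, hJSI ω h.2 h.1⟩, fun h => ⟨h.1, hISJ ω h.2 h.1⟩⟩
  have setIsSj : Is ∩ Sj = Sj ∩ Is := Set.inter_comm _ _
  have setIs_SjIj : Is ∩ (Sj ∪ Ij) = Is ∩ Ij := by
    ext ω; simp only [Set.mem_inter_iff, Set.mem_union]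
    constructor
    · rintro ⟨h1, h2 | h2⟩; exacts [⟨h1, hISJ ω h1 h2⟩, ⟨h1, h2⟩]
    · rintro ⟨h1, h2⟩; exact ⟨h1, Or.inr h2⟩
  have setSj_IsIj : Sj ∩ (Is ∩ Ij) = Sj ∩ Is := by
    ext ω; simp only [Set.mem_inter_iff]; exact ⟨fun h => ⟨h.1, h.2.1⟩, fun h => ⟨h.1, h.2, hISJ ω h.2 h.1⟩⟩
  have setIsIj_Sj : (Is ∪ Ij) ∩ Sj = Sj ∩ Is := by
    ext ω; simp only [Set.mem_inter_iff, Set.mem_union]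
    constructor
    · rintro ⟨h1 | h1, h2⟩; exacts [⟨h2, h1⟩, ⟨h2, hJSI ω h1 h2⟩]
    · rintro ⟨h1, h2⟩; exact ⟨Or.inl h2, h1⟩
  have subSjIs : Sj ∩ Is ⊆ Is ∩ Ij := fun ω h => ⟨h.2, hISJ ω h.2 h.1⟩
  have upSj : IsUpperSet Sj := fun ω ω' hle hω => reach_offRoot_mono hle hω
  have upIs : IsUpperSet Is := by rintro ω ω' hle ⟨u, hu, hsu, hr⟩; exact ⟨u, hu, hsu, reach_offRoot_mono hle hr⟩
  have hm : ∀ Z : Set (BondConfig (Fin n)), MeasurableSet Z := fun _ => MeasurableSet.of_discrete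
  set u := Q00.real Sj with hu; set PIs := Q00.real Is with hPIs; set PIj := Q00.real Ij with hPIj
  set PIsIj := Q00.real (Is ∩ Ij) with hPIsIj; set PSjIs := Q00.real (Sj ∪ Is) with hPSjIs; set PSjIj := Q00.real (Sj ∪ Ij) with hPSjIj
  set PSjIsIj := Q00.real (Sj ∪ (Is ∩ Ij)) with hPSjIsIj; set t := Q00.real (Sj ∩ Is) with ht
  have hSIe : PSjIs + t = u + PIs := by rw [hPSjIs, ht, hu, hPIs]; exact measureReal_union_add_inter (hm Is)
  have hSJe : PSjIj + t = u + PIj := by rw [hPSjIj, ht, hu, hPIj, ← setSjIj]; exact measureReal_union_add_inter (hm Ij)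
  have hSIJe : PSjIsIj + t = u + PIsIj := by
    rw [hPSjIsIj, ht, hu, hPIsIj, ← setSj_IsIj]; exact measureReal_union_add_inter (hm _)
  have hHar : PIs * u ≤ t := by
    rw [hPIs, hu, ht, ← setIsSj]; exact prodBernoulli_harris _ upIs upSj (hm _) (hm _)
  have hPIsIj_le_PIs : PIsIj ≤ PIs := measureReal_mono Set.inter_subset_left; have hPIsIj_le_PIj : PIsIj ≤ PIj := measureReal_mono Set.inter_subset_right
  have ht_le_PIsIj : t ≤ PIsIj := measureReal_mono subSjIs; have ht_le_u : t ≤ u := measureReal_mono Set.inter_subset_left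
  have ht0 : 0 ≤ t := measureReal_nonneg
  have hunion : PIs + PIj - PIsIj + u - t ≤ 1 := by
    have h1 : Q00.real (Is ∪ Ij) + PIsIj = PIs + PIj := by rw [hPIsIj, hPIs, hPIj]; exact measureReal_union_add_inter (hm Ij)
    have h2 : Q00.real (Is ∪ Ij ∪ Sj) + t = Q00.real (Is ∪ Ij) + u := by
      rw [ht, hu, ← setIsIj_Sj]; exact measureReal_union_add_inter (hm Sj)
    have h3 : Q00.real (Is ∪ Ij ∪ Sj) ≤ 1 := measureReal_le_one; linarith
  have wval := pin₂_update_apply w0 hne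
  have other_ne : ∀ v : Fin n, v ≠ s → v ≠ j → s(i, v) ≠ e₁ ∧ s(i, v) ≠ e₂ := fun v hvs hvj => rootPair_ne_of_ne hvs hvj
  have sure : ∀ (x y : unitInterval), (pin₂ w0 e₁ e₂ x y).real
      ({ω | ∀ f, Function.update (Function.update w0 e₁ x) e₂ y f = 1 → f ∈ ω} ∩
        {ω | ∀ f, Function.update (Function.update w0 e₁ x) e₂ y f = 0 → f ∉ ω}) = 1 := fun x y => real_sureSet _
  have ifree : ∀ (x y : unitInterval) (ω : BondConfig (Fin n)),
      ω ∈ ({ω | ∀ f, Function.update (Function.update w0 e₁ x) e₂ y f = 1 → f ∈ ω} ∩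
        {ω | ∀ f, Function.update (Function.update w0 e₁ x) e₂ y f = 0 → f ∉ ω} : Set (BondConfig (Fin n))) →
      ∀ v : Fin n, v ≠ i → v ≠ s → v ≠ j → s(i, v) ∉ ω := by
    intro x y ω hω v hvi hvs hvj; apply hω.2
    rw [wval, if_neg (other_ne v hvs hvj).2, if_neg (other_ne v hvs hvj).1]
    exact htarget v hvi hvs hvj
  have mem₂_one : ∀ (x : unitInterval) (ω : BondConfig (Fin n)),
      ω ∈ ({ω | ∀ f, Function.update (Function.update w0 e₁ x) e₂ 1 f = 1 → f ∈ ω} ∩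
        {ω | ∀ f, Function.update (Function.update w0 e₁ x) e₂ 1 f = 0 → f ∉ ω} : Set (BondConfig (Fin n))) → e₂ ∈ ω :=
    fun x ω hω => hω.1 e₂ (by rw [wval, if_pos rfl])
  have nmem₂_zero : ∀ (x : unitInterval) (ω : BondConfig (Fin n)),
      ω ∈ ({ω | ∀ f, Function.update (Function.update w0 e₁ x) e₂ 0 f = 1 → f ∈ ω} ∩
        {ω | ∀ f, Function.update (Function.update w0 e₁ x) e₂ 0 f = 0 → f ∉ ω} : Set (BondConfig (Fin n))) → e₂ ∉ ω :=
    fun x ω hω => hω.2 e₂ (by rw [wval, if_pos rfl])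
  have mem₁_one : ∀ (y : unitInterval) (ω : BondConfig (Fin n)),
      ω ∈ ({ω | ∀ f, Function.update (Function.update w0 e₁ 1) e₂ y f = 1 → f ∈ ω} ∩
        {ω | ∀ f, Function.update (Function.update w0 e₁ 1) e₂ y f = 0 → f ∉ ω} : Set (BondConfig (Fin n))) → e₁ ∈ ω :=
    fun y ω hω => hω.1 e₁ (by rw [wval, if_neg hne, if_pos rfl])
  have nmem₁_zero : ∀ (y : unitInterval) (ω : BondConfig (Fin n)),
      ω ∈ ({ω | ∀ f, Function.update (Function.update w0 e₁ 0) e₂ y f = 1 → f ∈ ω} ∩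
        {ω | ∀ f, Function.update (Function.update w0 e₁ 0) e₂ y f = 0 → f ∉ ω} : Set (BondConfig (Fin n))) → e₁ ∉ ω :=
    fun y ω hω => hω.2 e₁ (by rw [wval, if_neg hne, if_pos rfl])
  set G00 : Set (BondConfig (Fin n)) := {ω | ∀ f, Function.update (Function.update w0 e₁ 0) e₂ 0 f = 1 → f ∈ ω} ∩
    {ω | ∀ f, Function.update (Function.update w0 e₁ 0) e₂ 0 f = 0 → f ∉ ω} with hG00
  set G01 : Set (BondConfig (Fin n)) := {ω | ∀ f, Function.update (Function.update w0 e₁ 0) e₂ 1 f = 1 → f ∈ ω} ∩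
    {ω | ∀ f, Function.update (Function.update w0 e₁ 0) e₂ 1 f = 0 → f ∉ ω} with hG01
  set G10 : Set (BondConfig (Fin n)) := {ω | ∀ f, Function.update (Function.update w0 e₁ 1) e₂ 0 f = 1 → f ∈ ω} ∩
    {ω | ∀ f, Function.update (Function.update w0 e₁ 1) e₂ 0 f = 0 → f ∉ ω} with hG10
  set G11 : Set (BondConfig (Fin n)) := {ω | ∀ f, Function.update (Function.update w0 e₁ 1) e₂ 1 f = 1 → f ∈ ω} ∩
    {ω | ∀ f, Function.update (Function.update w0 e₁ 1) e₂ 1 f = 0 → f ∉ ω} with hG11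
  have s00 := sure 0 0; have s01 := sure 0 1; have s10 := sure 1 0; have s11 := sure 1 1
  have chBi : ∀ ω : BondConfig (Fin n), (∀ v : Fin n, v ≠ i → v ≠ s → v ≠ j → s(i, v) ∉ ω) →
      (ω ∈ Bi ↔ e₁ ∈ ω ∨ (e₂ ∈ ω ∧ ω ∈ Sj)) := by
    intro ω hω; rw [hBi, mem_openConn_rootPairs his.symm hij.symm hω, symSj ω]
  have chIJ : ∀ ω : BondConfig (Fin n), (∀ v : Fin n, v ≠ i → v ≠ s → v ≠ j → s(i, v) ∉ ω) →
      (ω ∈ IJ ↔ e₂ ∈ ω ∨ (e₁ ∈ ω ∧ ω ∈ Sj)) := by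
    intro ω hω; have hω' : ∀ v : Fin n, v ≠ i → v ≠ j → v ≠ s → s(i, v) ∉ ω := fun v h1 h2 h3 => hω v h1 h3 h2
    rw [hIJ, mem_openConn_rootPairs hij.symm his.symm hω']; exact Iff.rfl
  have chBj : ∀ ω : BondConfig (Fin n), ω ∈ Bj ↔ ω ∈ Sj ∨ (ω ∈ Bi ∧ ω ∈ IJ) := by
    intro ω; simp only [hBj, hBi, hIJ, openConn, Set.mem_setOf_eq]; rw [reach_split_at ω s i j]
    constructor
    · rintro (h | ⟨h1, h2⟩); exacts [Or.inl h, Or.inr ⟨h1.symm, h2⟩]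
    · rintro (h | ⟨h1, h2⟩); exacts [Or.inl h, Or.inr ⟨h1.symm, h2⟩]
  have chFBi : ∀ ω : BondConfig (Fin n), (∀ v : Fin n, v ≠ i → v ≠ s → v ≠ j → s(i, v) ∉ ω) →
      ((ω ∪ F : BondConfig (Fin n)) ∈ Bi ↔ e₁ ∈ ω ∨ (e₂ ∈ ω ∧ ω ∈ Sj) ∨ ω ∈ Is) := by
    intro ω hω; rw [hBi, union_mem_openConn_rootPairs his.symm hij.symm hF hFs hω, symSj ω]
    exact Iff.rfl
  have chFIJ : ∀ ω : BondConfig (Fin n), (∀ v : Fin n, v ≠ i → v ≠ s → v ≠ j → s(i, v) ∉ ω) →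
      ((ω ∪ F : BondConfig (Fin n)) ∈ IJ ↔ e₂ ∈ ω ∨ (e₁ ∈ ω ∧ ω ∈ Sj) ∨ ω ∈ Ij) := by
    intro ω hω; have hω' : ∀ v : Fin n, v ≠ i → v ≠ j → v ≠ s → s(i, v) ∉ ω := fun v h1 h2 h3 => hω v h1 h3 h2
    rw [hIJ, union_mem_openConn_rootPairs hij.symm his.symm hF hFj hω']
    exact Iff.rfl
  have chFBj : ∀ ω : BondConfig (Fin n),
      ((ω ∪ F : BondConfig (Fin n)) ∈ Bj ↔ ω ∈ Sj ∨ ((ω ∪ F : BondConfig (Fin n)) ∈ Bi ∧ (ω ∪ F : BondConfig (Fin n)) ∈ IJ)) := by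
    intro ω; rw [chBj (ω ∪ F), unionSj ω]
  have zero00 : ∀ Z : Set (BondConfig (Fin n)), (∀ ω ∈ G00, ω ∉ Z) → Q00.real Z = 0 := by
    intro Z hZ; have h0 : Q00.real (∅ : Set (BondConfig (Fin n))) = 0 := by simp
    rw [← h0]; refine real_congr_on_sure s00 fun ω hω => ?_; simp only [Set.mem_empty_iff_false, iff_false]; exact hZ ω hω
  have nBi00 : ∀ ω ∈ G00, ω ∉ Bi := by
    intro ω hω h; rw [chBi ω (ifree 0 0 ω hω)] at h
    exact h.elim (nmem₁_zero 0 ω hω) (fun h' => nmem₂_zero 0 ω hω h'.1)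
  have v00_i : Q00.real Bi = 0 := zero00 _ nBi00; have v00_ij : Q00.real (Bi ∩ Bj) = 0 := zero00 _ fun ω hω h => nBi00 ω hω h.1
  have v00_j : Q00.real Bj = u := by
    rw [hu]; refine real_congr_on_sure s00 fun ω hω => ?_
    rw [chBj ω]
    exact ⟨fun h => h.elim id (fun h' => absurd h'.1 (nBi00 ω hω)), fun h => Or.inl h⟩
  have f00_i : Q00.real ((fun ω : BondConfig (Fin n) => ω ∪ F) ⁻¹' Bi) = PIs := by
    rw [hPIs]; refine real_congr_on_sure s00 fun ω hω => ?_
    have h1 := nmem₁_zero 0 ω hω; have h2 := nmem₂_zero 0 ω hω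
    simp only [Set.mem_preimage]; rw [chFBi ω (ifree 0 0 ω hω)]
    exact ⟨fun h => h.elim (fun h' => absurd h' h1) (fun h' => h'.elim (fun h'' => absurd h''.1 h2) id), fun h => Or.inr (Or.inr h)⟩
  have f00_j : Q00.real ((fun ω : BondConfig (Fin n) => ω ∪ F) ⁻¹' Bj) = PSjIsIj := by
    rw [hPSjIsIj]; refine real_congr_on_sure s00 fun ω hω => ?_
    have h1 := nmem₁_zero 0 ω hω; have h2 := nmem₂_zero 0 ω hω
    simp only [Set.mem_preimage, Set.mem_union, Set.mem_inter_iff]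
    rw [chFBj ω, chFBi ω (ifree 0 0 ω hω), chFIJ ω (ifree 0 0 ω hω)]
    constructor
    · rintro (h | ⟨hi, hj⟩)
      · exact Or.inl h
      · have hi' : ω ∈ Is := hi.elim (fun h' => absurd h' h1) (fun h' => h'.elim (fun h'' => absurd h''.1 h2) id)
        have hj' : ω ∈ Sj ∨ ω ∈ Ij := hj.elim (fun h' => absurd h' h2) (fun h' => h'.elim (fun h'' => absurd h''.1 h1) Or.inr)
        exact hj'.elim Or.inl (fun h'' => Or.inr ⟨hi', h''⟩)
    · rintro (h | ⟨hi, hj⟩)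
      · exact Or.inl h
      · exact Or.inr ⟨Or.inr (Or.inr hi), Or.inr (Or.inr hj)⟩
  have f00_ij : Q00.real ((fun ω : BondConfig (Fin n) => ω ∪ F) ⁻¹' (Bi ∩ Bj)) = PIsIj := by
    rw [hPIsIj, ← setIs_SjIj]; refine real_congr_on_sure s00 fun ω hω => ?_
    have h1 := nmem₁_zero 0 ω hω; have h2 := nmem₂_zero 0 ω hω
    simp only [Set.mem_preimage, Set.mem_union, Set.mem_inter_iff]
    rw [chFBj ω, chFBi ω (ifree 0 0 ω hω), chFIJ ω (ifree 0 0 ω hω)]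
    constructor
    · rintro ⟨hi, hj⟩
      have hi' : ω ∈ Is := hi.elim (fun h' => absurd h' h1) (fun h' => h'.elim (fun h'' => absurd h''.1 h2) id)
      refine ⟨hi', ?_⟩
      rcases hj with h | ⟨-, hj2⟩
      · exact Or.inl h
      · exact hj2.elim (fun h' => absurd h' h2) (fun h' => h'.elim (fun h'' => absurd h''.1 h1) Or.inr)
    · rintro ⟨hi, hj⟩
      refine ⟨Or.inr (Or.inr hi), ?_⟩
      rcases hj with h | h
      · exact Or.inl h
      · exact Or.inr ⟨Or.inr (Or.inr hi), Or.inr (Or.inr h)⟩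
  have v01_i : Q01.real Bi = u := by
    have step : Q01.real Bi = Q01.real Sj := by
      refine real_congr_on_sure s01 fun ω hω => ?_
      have h1 := nmem₁_zero 1 ω hω; have h2 := mem₂_one 0 ω hω
      rw [chBi ω (ifree 0 1 ω hω)]
      exact ⟨fun h => h.elim (fun h' => absurd h' h1) (fun h' => h'.2), fun h => Or.inr ⟨h2, h⟩⟩
    rw [step, cpl01, hu]; congr 1; ext ω; exact insSj hi₂ ω
  have v01_j : Q01.real Bj = u := by
    have step : Q01.real Bj = Q01.real Sj := by
      refine real_congr_on_sure s01 fun ω hω => ?_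
      have h1 := nmem₁_zero 1 ω hω
      rw [chBj ω, chBi ω (ifree 0 1 ω hω)]
      constructor
      · rintro (h | ⟨hi, -⟩)
        · exact h
        · exact hi.elim (fun h' => absurd h' h1) (fun h' => h'.2)
      · exact fun h => Or.inl h
    rw [step, cpl01, hu]; congr 1; ext ω; exact insSj hi₂ ω
  have v01_ij : Q01.real (Bi ∩ Bj) = u := by
    have step : Q01.real (Bi ∩ Bj) = Q01.real Sj := by
      refine real_congr_on_sure s01 fun ω hω => ?_
      have h1 := nmem₁_zero 1 ω hω; have h2 := mem₂_one 0 ω hω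
      simp only [Set.mem_inter_iff]
      rw [chBj ω, chBi ω (ifree 0 1 ω hω)]
      exact ⟨fun ⟨hi, _⟩ => hi.elim (fun h' => absurd h' h1) (fun h' => h'.2), fun h => ⟨Or.inr ⟨h2, h⟩, Or.inl h⟩⟩
    rw [step, cpl01, hu]; congr 1; ext ω; exact insSj hi₂ ω
  have f01_i : Q01.real ((fun ω : BondConfig (Fin n) => ω ∪ F) ⁻¹' Bi) = PSjIs := by
    have step : Q01.real ((fun ω : BondConfig (Fin n) => ω ∪ F) ⁻¹' Bi) = Q01.real (Sj ∪ Is) := by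
      refine real_congr_on_sure s01 fun ω hω => ?_
      have h1 := nmem₁_zero 1 ω hω; have h2 := mem₂_one 0 ω hω
      simp only [Set.mem_preimage, Set.mem_union]; rw [chFBi ω (ifree 0 1 ω hω)]
      constructor
      · rintro (h' | h' | h'); exacts [absurd h' h1, Or.inl h'.2, Or.inr h']
      · rintro (h | h); exacts [Or.inr (Or.inl ⟨h2, h⟩), Or.inr (Or.inr h)]
    rw [step, cpl01, hPSjIs]; congr 1; ext ω; simp only [Set.mem_preimage, Set.mem_union]; rw [insSj hi₂ ω, insIs hi₂ ω]
  have f01_j : Q01.real ((fun ω : BondConfig (Fin n) => ω ∪ F) ⁻¹' Bj) = PSjIs := by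
    have step : Q01.real ((fun ω : BondConfig (Fin n) => ω ∪ F) ⁻¹' Bj) = Q01.real (Sj ∪ Is) := by
      refine real_congr_on_sure s01 fun ω hω => ?_
      have h1 := nmem₁_zero 1 ω hω; have h2 := mem₂_one 0 ω hω
      simp only [Set.mem_preimage, Set.mem_union]
      rw [chFBj ω, chFBi ω (ifree 0 1 ω hω), chFIJ ω (ifree 0 1 ω hω)]
      constructor
      · rintro (h | ⟨hi, -⟩)
        · exact Or.inl h
        · rcases hi with h' | h' | h'; exacts [absurd h' h1, Or.inl h'.2, Or.inr h']
      · rintro (h | h); exacts [Or.inl h, Or.inr ⟨Or.inr (Or.inr h), Or.inl h2⟩]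
    rw [step, cpl01, hPSjIs]; congr 1; ext ω; simp only [Set.mem_preimage, Set.mem_union]; rw [insSj hi₂ ω, insIs hi₂ ω]
  have f01_ij : Q01.real ((fun ω : BondConfig (Fin n) => ω ∪ F) ⁻¹' (Bi ∩ Bj)) = PSjIs := by
    have step : Q01.real ((fun ω : BondConfig (Fin n) => ω ∪ F) ⁻¹' (Bi ∩ Bj)) = Q01.real (Sj ∪ Is) := by
      refine real_congr_on_sure s01 fun ω hω => ?_
      have h1 := nmem₁_zero 1 ω hω; have h2 := mem₂_one 0 ω hω
      simp only [Set.mem_preimage, Set.mem_union, Set.mem_inter_iff]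
      rw [chFBj ω, chFBi ω (ifree 0 1 ω hω), chFIJ ω (ifree 0 1 ω hω)]
      constructor
      · rintro ⟨hi, -⟩
        rcases hi with h' | h' | h'; exacts [absurd h' h1, Or.inl h'.2, Or.inr h']
      · rintro (h | h); exacts [⟨Or.inr (Or.inl ⟨h2, h⟩), Or.inl h⟩, ⟨Or.inr (Or.inr h), Or.inr ⟨Or.inr (Or.inr h), Or.inl h2⟩⟩]
    rw [step, cpl01, hPSjIs]; congr 1; ext ω; simp only [Set.mem_preimage, Set.mem_union]; rw [insSj hi₂ ω, insIs hi₂ ω]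
  have v10_i : Q10.real Bi = 1 := by
    rw [← probReal_univ (μ := Q10)]; refine real_congr_on_sure s10 fun ω hω => ?_
    simp only [Set.mem_univ, iff_true]; rw [chBi ω (ifree 1 0 ω hω)]; exact Or.inl (mem₁_one 0 ω hω)
  have v10_j : Q10.real Bj = u := by
    have step : Q10.real Bj = Q10.real Sj := by
      refine real_congr_on_sure s10 fun ω hω => ?_
      have h1 := mem₁_one 0 ω hω; have h2 := nmem₂_zero 1 ω hω
      rw [chBj ω, chIJ ω (ifree 1 0 ω hω)]
      constructor
      · rintro (h | ⟨-, hj⟩)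
        · exact h
        · exact hj.elim (fun h' => absurd h' h2) (fun h' => h'.2)
      · exact fun h => Or.inl h
    rw [step, cpl10, hu]; congr 1; ext ω; exact insSj hi₁ ω
  have v10_ij : Q10.real (Bi ∩ Bj) = u := by
    have step : Q10.real (Bi ∩ Bj) = Q10.real Sj := by
      refine real_congr_on_sure s10 fun ω hω => ?_
      have h1 := mem₁_one 0 ω hω; have h2 := nmem₂_zero 1 ω hω
      simp only [Set.mem_inter_iff]
      rw [chBj ω, chBi ω (ifree 1 0 ω hω), chIJ ω (ifree 1 0 ω hω)]
      constructor
      · rintro ⟨-, hj⟩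
        rcases hj with h | ⟨-, hj2⟩
        · exact h
        · exact hj2.elim (fun h' => absurd h' h2) (fun h' => h'.2)
      · intro h; exact ⟨Or.inl h1, Or.inl h⟩
    rw [step, cpl10, hu]; congr 1; ext ω; exact insSj hi₁ ω
  have f10_i : Q10.real ((fun ω : BondConfig (Fin n) => ω ∪ F) ⁻¹' Bi) = 1 := by
    rw [← probReal_univ (μ := Q10)]; refine real_congr_on_sure s10 fun ω hω => ?_
    simp only [Set.mem_preimage, Set.mem_univ, iff_true]; rw [chFBi ω (ifree 1 0 ω hω)]; exact Or.inl (mem₁_one 0 ω hω)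
  have f10_j : Q10.real ((fun ω : BondConfig (Fin n) => ω ∪ F) ⁻¹' Bj) = PSjIj := by
    have step : Q10.real ((fun ω : BondConfig (Fin n) => ω ∪ F) ⁻¹' Bj) = Q10.real (Sj ∪ Ij) := by
      refine real_congr_on_sure s10 fun ω hω => ?_
      have h1 := mem₁_one 0 ω hω; have h2 := nmem₂_zero 1 ω hω
      simp only [Set.mem_preimage, Set.mem_union]
      rw [chFBj ω, chFBi ω (ifree 1 0 ω hω), chFIJ ω (ifree 1 0 ω hω)]
      constructor
      · rintro (h | ⟨-, hj⟩)
        · exact Or.inl h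
        · rcases hj with h' | h' | h'; exacts [absurd h' h2, Or.inl h'.2, Or.inr h']
      · rintro (h | h); exacts [Or.inl h, Or.inr ⟨Or.inl h1, Or.inr (Or.inr h)⟩]
    rw [step, cpl10, hPSjIj]; congr 1; ext ω; simp only [Set.mem_preimage, Set.mem_union]; rw [insSj hi₁ ω, insIj hi₁ ω]
  have f10_ij : Q10.real ((fun ω : BondConfig (Fin n) => ω ∪ F) ⁻¹' (Bi ∩ Bj)) = PSjIj := by
    have step : Q10.real ((fun ω : BondConfig (Fin n) => ω ∪ F) ⁻¹' (Bi ∩ Bj)) = Q10.real (Sj ∪ Ij) := by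
      refine real_congr_on_sure s10 fun ω hω => ?_
      have h1 := mem₁_one 0 ω hω; have h2 := nmem₂_zero 1 ω hω
      simp only [Set.mem_preimage, Set.mem_union, Set.mem_inter_iff]
      rw [chFBj ω, chFBi ω (ifree 1 0 ω hω), chFIJ ω (ifree 1 0 ω hω)]
      constructor
      · rintro ⟨-, hj⟩
        rcases hj with h | ⟨-, hj2⟩
        · exact Or.inl h
        · rcases hj2 with h' | h' | h'; exacts [absurd h' h2, Or.inl h'.2, Or.inr h']
      · rintro (h | h); exacts [⟨Or.inl h1, Or.inl h⟩, ⟨Or.inl h1, Or.inr ⟨Or.inl h1, Or.inr (Or.inr h)⟩⟩]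
    rw [step, cpl10, hPSjIj]; congr 1; ext ω; simp only [Set.mem_preimage, Set.mem_union]; rw [insSj hi₁ ω, insIj hi₁ ω]
  have one11 : ∀ Z : Set (BondConfig (Fin n)), (∀ ω ∈ G11, ω ∈ Z) → Q11.real Z = 1 := by
    intro Z hZ; rw [← probReal_univ (μ := Q11)]
    refine real_congr_on_sure s11 fun ω hω => ?_; simp only [Set.mem_univ, iff_true]; exact hZ ω hω
  have B11 : ∀ ω ∈ G11, ω ∈ Bi ∧ ω ∈ Bj := by
    intro ω hω
    have hb : ω ∈ Bi := by rw [chBi ω (ifree 1 1 ω hω)]; exact Or.inl (mem₁_one 1 ω hω)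
    refine ⟨hb, ?_⟩
    rw [chBj ω, chIJ ω (ifree 1 1 ω hω)]; exact Or.inr ⟨hb, Or.inl (mem₂_one 1 ω hω)⟩
  have FB11 : ∀ ω ∈ G11, (ω ∪ F : BondConfig (Fin n)) ∈ Bi ∧ (ω ∪ F : BondConfig (Fin n)) ∈ Bj := by
    intro ω hω
    have hb : (ω ∪ F : BondConfig (Fin n)) ∈ Bi := by rw [chFBi ω (ifree 1 1 ω hω)]; exact Or.inl (mem₁_one 1 ω hω)
    refine ⟨hb, ?_⟩
    rw [chFBj ω, chFIJ ω (ifree 1 1 ω hω)]; exact Or.inr ⟨hb, Or.inl (mem₂_one 1 ω hω)⟩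
  have v11_i : Q11.real Bi = 1 := one11 _ fun ω hω => (B11 ω hω).1; have v11_j : Q11.real Bj = 1 := one11 _ fun ω hω => (B11 ω hω).2
  have v11_ij : Q11.real (Bi ∩ Bj) = 1 := one11 _ fun ω hω => ⟨(B11 ω hω).1, (B11 ω hω).2⟩; have f11_i : Q11.real ((fun ω : BondConfig (Fin n) => ω ∪ F) ⁻¹' Bi) = 1 := one11 _ fun ω hω => (FB11 ω hω).1
  have f11_j : Q11.real ((fun ω : BondConfig (Fin n) => ω ∪ F) ⁻¹' Bj) = 1 := one11 _ fun ω hω => (FB11 ω hω).2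
  have f11_ij : Q11.real ((fun ω : BondConfig (Fin n) => ω ∪ F) ⁻¹' (Bi ∩ Bj)) = 1 :=
    one11 _ fun ω hω => ⟨(FB11 ω hω).1, (FB11 ω hω).2⟩
  have eA1 : (prodBernoulli w1).real Bi = (1 - a) * (1 - c) * PIs + (1 - a) * c * PSjIs + a * (1 - c) * 1 + a * c * 1 := by
    rw [real_twoBondDecomp w1 hne Bi, hw1e₁, hw1e₂, cplF 0 0, cplF 0 1, cplF 1 0, cplF 1 1, ← hQ00, ← hQ01, ← hQ10, ← hQ11,
      f00_i, f01_i, f10_i, f11_i]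
  have eB1 : (prodBernoulli w1).real Bj = (1 - a) * (1 - c) * PSjIsIj + (1 - a) * c * PSjIs + a * (1 - c) * PSjIj + a * c * 1 := by
    rw [real_twoBondDecomp w1 hne Bj, hw1e₁, hw1e₂, cplF 0 0, cplF 0 1, cplF 1 0, cplF 1 1, ← hQ00, ← hQ01, ← hQ10, ← hQ11,
      f00_j, f01_j, f10_j, f11_j]
  have eD1 : (prodBernoulli w1).real (Bi ∩ Bj) = (1 - a) * (1 - c) * PIsIj + (1 - a) * c * PSjIs + a * (1 - c) * PSjIj + a * c * 1 := by
    rw [real_twoBondDecomp w1 hne (Bi ∩ Bj), hw1e₁, hw1e₂, cplF 0 0, cplF 0 1, cplF 1 0, cplF 1 1, ← hQ00, ← hQ01, ← hQ10, ← hQ11,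
      f00_ij, f01_ij, f10_ij, f11_ij]
  have eA0 : (prodBernoulli w0).real Bi = (1 - a) * (1 - c) * 0 + (1 - a) * c * u + a * (1 - c) * 1 + a * c * 1 := by
    rw [real_twoBondDecomp w0 hne Bi, ← ha, ← hc, ← hQ00, ← hQ01, ← hQ10, ← hQ11, v00_i, v01_i, v10_i, v11_i]
  have eB0 : (prodBernoulli w0).real Bj = (1 - a) * (1 - c) * u + (1 - a) * c * u + a * (1 - c) * u + a * c * 1 := by
    rw [real_twoBondDecomp w0 hne Bj, ← ha, ← hc, ← hQ00, ← hQ01, ← hQ10, ← hQ11, v00_j, v01_j, v10_j, v11_j]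
  have eD0 : (prodBernoulli w0).real (Bi ∩ Bj) = (1 - a) * (1 - c) * 0 + (1 - a) * c * u + a * (1 - c) * u + a * c * 1 := by
    rw [real_twoBondDecomp w0 hne (Bi ∩ Bj), ← ha, ← hc, ← hQ00, ← hQ01, ← hQ10, ← hQ11, v00_ij, v01_ij, v10_ij, v11_ij]
  have hIUcore : (PIs - PIsIj + (PIsIj - t) + t) * (u - t + t) ≤ t := by
    have e1 : (PIs - PIsIj + (PIsIj - t) + t) * (u - t + t) = PIs * u := by ring
    rw [e1]; exact hHar
  have core := allOrNothing_target_core a c (u - t) (PIs - PIsIj) (PIj - PIsIj) (PIsIj - t) t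
    ((prodBernoulli w1).real Bi) ((prodBernoulli w1).real Bj) ((prodBernoulli w1).real (Bi ∩ Bj))
    ((prodBernoulli w0).real Bi) ((prodBernoulli w0).real Bj) ((prodBernoulli w0).real (Bi ∩ Bj))
    ha0 ha1 hc0 hc1 (by linarith) (by linarith) (by linarith) (by linarith) ht0 (by linarith) hIUcore
    (by rw [eA1]; linear_combination (1 - a) * c * hSIe)
    (by rw [eB1]; linear_combination (1 - a) * (1 - c) * hSIJe + (1 - a) * c * hSIe + a * (1 - c) * hSJe)
    (by rw [eD1]; linear_combination (1 - a) * c * hSIe + a * (1 - c) * hSJe)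
    (by rw [eA0]; ring) (by rw [eB0]; ring) (by rw [eD0]; ring)
  linarith [core]

end IncStar

end Summit.CriticalPhenomena.PercolationContinuityZ3.Theorems
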